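import Summits.AnomalousDissipation.AnomalousDissipation.Theorems.SolenoidalFractalHomogenisationLagrangianStepTemplateAsymptotics
import HarnessLib

/-!
# Template asymptotics (II): the relative gain is large and the dissipation scale `R_m = kbar m · N m²` tends to infinity (K1L_D helper)

Companion of `…LagrangianStepTemplateAsymptotics` (same seat, same purpose: the `m⋆` bookkeeping of the registered stub `stub_oneLevelL_IW` of
crux K1L_D `LagrangianRenormalisationStepDesign`, stmt-AnomalousDissipation-27980), in the template variable `s_m := (N (m+1) / N m)^{1/16}`:

* § 3 the RELATIVE GAIN of the one-level step is large: `gain · s_m ^ 8 ≤ gain / cellVisc (m+1) ^ 2 ≤ gain · s_m ^ 24 / K ^ 2` ((T2), (T3)),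
  and `gain / cellVisc (m+1)² → ∞`;
* § 4 the DISSIPATION SCALE `R_m := kbar m · N m ^ 2` (`= a m · cellVisc m`) obeys the one-step identity
  `R_{m+1} · (1 + gain / cellVisc (m+1)²) = R_m · s_m ^ 32` (Taylor recursion of `Permissible` × `N (m+1) = s_m¹⁶ N m`) and hence the growth
  `R_{m+1} ≥ (K² / (K² + gain)) · s_m ^ 8 · R_m`; so `R_m → ∞`: `∀ B, ∃ m⋆, ∀ m ≥ m⋆, B ≤ kbar m · N m ^ 2` — the threshold behind items 1–2 of
  the lead's consumer memo `Cruxes/LagrangianRenormalisationStep/B-lead-1.md` (class-`R` datum tail `≤ R·E₀·ρ^{1/4}/(4π² N m²)` and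
  decay-relative corrector content `≤ C/(8π²·lo·t·R_{m+1})`, both `o(drop)` once `R_m` is large).

Pure real arithmetic on `FractalCarrierData` (no carrier analysis, no definitions, no named facts, no sorry); cites only the bookkeeping of
[ArmstrongVicol2025, §3 (3.42)–(3.43)] through the tree's `Permissible`.  This is NOT a proof of the one-level comparison, of the crux, of
Onsager's conjecture or of anomalous dissipation — rung-leaf F-D1.A0 bookkeeping only.  Prover seat `ad-k3l-bookkeeping-p1` g4, 2026-08-28.
-/

set_option linter.dupNamespace false

noncomputable section

namespace Summit.AnomalousDissipation.AnomalousDissipation.Theorems.SolenoidalFractalHomogenisation.LagrangianStep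

open Filter Topology
open Literature.Analysis.FluidPDE.LatticeShear
open Summit.AnomalousDissipation.AnomalousDissipation.Theorems.SolenoidalFractalHomogenisation.LagrangianRenormalisationStep (cellVisc_pos')

variable {k : ℕ} (D : FractalCarrierData k)

/-! ## § 3. The relative gain `gain / cellVisc (m+1)²` is large -/

/-- (T2): `gain · s_m ^ 8 ≤ gain / cellVisc (m+1) ^ 2` — the one-level step runs in the LARGE-GAIN regime. [folklore] -/
theorem gain_mul_sep16_pow_eight_le_relGain
    (hT2 : ∀ m, D.cellVisc (m + 1) * ((D.N (m + 1) : ℝ) / D.N m) ^ (1 / 4 : ℝ) ≤ 1) (m : ℕ) :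
    D.gain * (((D.N (m + 1) : ℝ) / D.N m) ^ (1 / 16 : ℝ)) ^ 8 ≤ D.gain / D.cellVisc (m + 1) ^ 2 := by
  have hs := sep16_pos D m
  have hν := cellVisc_pos' D (m + 1)
  have hg := D.gain_pos
  have h2 := cellVisc_succ_mul_sep16_pow_four_le_one D hT2 m
  rw [le_div_iff₀ (pow_pos hν 2)]
  have h3 : (D.cellVisc (m + 1) * (((D.N (m + 1) : ℝ) / D.N m) ^ (1 / 16 : ℝ)) ^ 4) ^ 2 ≤ 1 := by
    have h0 : 0 ≤ D.cellVisc (m + 1) * (((D.N (m + 1) : ℝ) / D.N m) ^ (1 / 16 : ℝ)) ^ 4 := by positivity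
    nlinarith
  calc D.gain * (((D.N (m + 1) : ℝ) / D.N m) ^ (1 / 16 : ℝ)) ^ 8 * D.cellVisc (m + 1) ^ 2
      = D.gain * (D.cellVisc (m + 1) * (((D.N (m + 1) : ℝ) / D.N m) ^ (1 / 16 : ℝ)) ^ 4) ^ 2 := by ring
    _ ≤ D.gain * 1 := mul_le_mul_of_nonneg_left h3 hg.le
    _ = D.gain := mul_one _

/-- (T3): `gain / cellVisc (m+1) ^ 2 ≤ gain · s_m ^ 24 / K ^ 2`. [folklore] -/
theorem relGain_le_gain_mul_sep16_pow_div
    (hT3 : ∀ m, D.K * ((D.N (m + 1) : ℝ) / D.N m) ^ (1 / 4 : ℝ) ≤ ((D.N (m + 1) : ℝ) / D.N m) * D.cellVisc (m + 1)) (m : ℕ) :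
    D.gain / D.cellVisc (m + 1) ^ 2 ≤ D.gain * (((D.N (m + 1) : ℝ) / D.N m) ^ (1 / 16 : ℝ)) ^ 24 / D.K ^ 2 := by
  have hs := sep16_pos D m
  have hν := cellVisc_pos' D (m + 1)
  have hg := D.gain_pos
  have hK := D.K_pos
  have h1 := K_div_sep16_pow_twelve_le_cellVisc_succ D hT3 m
  have hKs : 0 < D.K / (((D.N (m + 1) : ℝ) / D.N m) ^ (1 / 16 : ℝ)) ^ 12 := by positivity
  calc D.gain / D.cellVisc (m + 1) ^ 2 ≤ D.gain / (D.K / (((D.N (m + 1) : ℝ) / D.N m) ^ (1 / 16 : ℝ)) ^ 12) ^ 2 :=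
        div_le_div_of_nonneg_left hg.le (pow_pos hKs 2) (pow_le_pow_left₀ hKs.le h1 2)
    _ = D.gain * (((D.N (m + 1) : ℝ) / D.N m) ^ (1 / 16 : ℝ)) ^ 24 / D.K ^ 2 := by
        field_simp

/-- **The relative gain tends to infinity** along the template. [folklore] -/
theorem tendsto_relGain_atTop (hP : D.Permissible)
    (hT2 : ∀ m, D.cellVisc (m + 1) * ((D.N (m + 1) : ℝ) / D.N m) ^ (1 / 4 : ℝ) ≤ 1)
    (hsq : ∀ m, D.N m ^ 2 ≤ D.N (m + 1)) :
    Tendsto (fun m => D.gain / D.cellVisc (m + 1) ^ 2) atTop atTop := by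
  have hgs : Tendsto (fun m : ℕ => D.gain * ((D.N (m + 1) : ℝ) / D.N m) ^ (1 / 16 : ℝ)) atTop atTop :=
    (tendsto_sep16_atTop D hP hsq).const_mul_atTop D.gain_pos
  refine tendsto_atTop_mono (fun m => ?_) hgs
  have hs1 := one_le_sep16 D hP m
  -- `s ≤ s ^ 8` since `s ≥ 1`
  have hle : ((D.N (m + 1) : ℝ) / D.N m) ^ (1 / 16 : ℝ) ≤ (((D.N (m + 1) : ℝ) / D.N m) ^ (1 / 16 : ℝ)) ^ 8 := by
    calc ((D.N (m + 1) : ℝ) / D.N m) ^ (1 / 16 : ℝ) = (((D.N (m + 1) : ℝ) / D.N m) ^ (1 / 16 : ℝ)) ^ 1 := (pow_one _).symm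
      _ ≤ (((D.N (m + 1) : ℝ) / D.N m) ^ (1 / 16 : ℝ)) ^ 8 := pow_le_pow_right₀ hs1 (by norm_num)
  exact (mul_le_mul_of_nonneg_left hle D.gain_pos.le).trans (gain_mul_sep16_pow_eight_le_relGain D hT2 m)

/-! ## § 4. The dissipation scale `R_m = kbar m · N m²` grows without bound -/

/-- **One-step identity**: `kbar (m+1) · N (m+1)² · (1 + gain / cellVisc (m+1)²) = kbar m · N m² · s_m ^ 32` (Taylor recursion ×
`N (m+1) = s_m¹⁶ N m`). [cite: ArmstrongVicol2025, §3 (3.42)–(3.43) (parameter bookkeeping, transposed)] -/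
theorem R_succ_mul_gainFactor_eq (hP : D.Permissible) (m : ℕ) :
    D.kbar (m + 1) * (D.N (m + 1) : ℝ) ^ 2 * (1 + D.gain / D.cellVisc (m + 1) ^ 2) =
      D.kbar m * (D.N m : ℝ) ^ 2 * (((D.N (m + 1) : ℝ) / D.N m) ^ (1 / 16 : ℝ)) ^ 32 := by
  have hrec := hP.2.2.2.1 m
  have ha : D.a (m + 1) ≠ 0 := (D.a_pos _).ne'
  have hk : D.kbar (m + 1) ≠ 0 := (D.kbar_pos _).ne'
  have hN : (D.N (m + 1) : ℝ) ≠ 0 := by exact_mod_cast (D.N_pos _).ne'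
  have hNm : (D.N m : ℝ) ≠ 0 := by exact_mod_cast (D.N_pos m).ne'
  have hrel : D.gain / D.cellVisc (m + 1) ^ 2 = D.gain * D.a (m + 1) ^ 2 / (D.kbar (m + 1) ^ 2 * (D.N (m + 1) : ℝ) ^ 4) := by
    unfold FractalCarrierData.cellVisc
    field_simp
  have e32 : (((D.N (m + 1) : ℝ) / D.N m) ^ (1 / 16 : ℝ)) ^ 32 = ((D.N (m + 1) : ℝ) / D.N m) ^ 2 := by
    rw [show (32 : ℕ) = 16 * 2 from rfl, pow_mul, sep16_pow_sixteen]
  calc D.kbar (m + 1) * (D.N (m + 1) : ℝ) ^ 2 * (1 + D.gain / D.cellVisc (m + 1) ^ 2)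
      = (D.kbar (m + 1) * (1 + D.gain * D.a (m + 1) ^ 2 / (D.kbar (m + 1) ^ 2 * (D.N (m + 1) : ℝ) ^ 4))) *
          (D.N (m + 1) : ℝ) ^ 2 := by rw [hrel]; ring
    _ = D.kbar m * (D.N (m + 1) : ℝ) ^ 2 := by rw [← hrec]
    _ = D.kbar m * (D.N m : ℝ) ^ 2 * (((D.N (m + 1) : ℝ) / D.N m) ^ (1 / 16 : ℝ)) ^ 32 := by
        rw [e32]
        field_simp

/-- **One-step growth**: `(K² / (K² + gain)) · s_m ^ 8 · (kbar m · N m²) ≤ kbar (m+1) · N (m+1)²` ((T3) bounds the gain factor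
`1 + gain/cellVisc² ≤ 1 + gain s²⁴/K² ≤ (K² + gain) s²⁴ / K²`). [folklore] -/
theorem R_succ_ge (hP : D.Permissible)
    (hT3 : ∀ m, D.K * ((D.N (m + 1) : ℝ) / D.N m) ^ (1 / 4 : ℝ) ≤ ((D.N (m + 1) : ℝ) / D.N m) * D.cellVisc (m + 1)) (m : ℕ) :
    D.K ^ 2 / (D.K ^ 2 + D.gain) * (((D.N (m + 1) : ℝ) / D.N m) ^ (1 / 16 : ℝ)) ^ 8 * (D.kbar m * (D.N m : ℝ) ^ 2) ≤
      D.kbar (m + 1) * (D.N (m + 1) : ℝ) ^ 2 := by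
  set s : ℝ := ((D.N (m + 1) : ℝ) / D.N m) ^ (1 / 16 : ℝ) with hs_def
  have hs : 0 < s := sep16_pos D m
  have hs1 : 1 ≤ s := one_le_sep16 D hP m
  have hK := D.K_pos
  have hg := D.gain_pos
  have hR : 0 < D.kbar m * (D.N m : ℝ) ^ 2 := by
    have := D.kbar_pos m
    have : (0 : ℝ) < D.N m := by exact_mod_cast D.N_pos m
    positivity
  have hR' : 0 < D.kbar (m + 1) * (D.N (m + 1) : ℝ) ^ 2 := by
    have := D.kbar_pos (m + 1)
    have : (0 : ℝ) < D.N (m + 1) := by exact_mod_cast D.N_pos (m + 1)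
    positivity
  have hid := R_succ_mul_gainFactor_eq D hP m
  rw [← hs_def] at hid
  -- the gain factor is at most `(K² + gain) s²⁴ / K²`
  have hG : 1 + D.gain / D.cellVisc (m + 1) ^ 2 ≤ (D.K ^ 2 + D.gain) * s ^ 24 / D.K ^ 2 := by
    have h1 := relGain_le_gain_mul_sep16_pow_div D hT3 m
    rw [← hs_def] at h1
    have h24 : 1 ≤ s ^ 24 := one_le_pow₀ hs1
    have e : (D.K ^ 2 + D.gain) * s ^ 24 / D.K ^ 2 = s ^ 24 + D.gain * s ^ 24 / D.K ^ 2 := by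
      field_simp
    rw [e]
    linarith
  have hGpos : 0 < 1 + D.gain / D.cellVisc (m + 1) ^ 2 := by
    have : 0 ≤ D.gain / D.cellVisc (m + 1) ^ 2 := div_nonneg hg.le (sq_nonneg _)
    linarith
  -- `R' = R s³² / G ≥ R s³² K² / ((K² + gain) s²⁴) = (K²/(K²+gain)) s⁸ R`
  have h1 : D.kbar (m + 1) * (D.N (m + 1) : ℝ) ^ 2 = D.kbar m * (D.N m : ℝ) ^ 2 * s ^ 32 / (1 + D.gain / D.cellVisc (m + 1) ^ 2) := by
    rw [← hid, mul_div_cancel_right₀ _ hGpos.ne']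
  rw [h1, le_div_iff₀ hGpos]
  calc D.K ^ 2 / (D.K ^ 2 + D.gain) * s ^ 8 * (D.kbar m * (D.N m : ℝ) ^ 2) * (1 + D.gain / D.cellVisc (m + 1) ^ 2)
      ≤ D.K ^ 2 / (D.K ^ 2 + D.gain) * s ^ 8 * (D.kbar m * (D.N m : ℝ) ^ 2) * ((D.K ^ 2 + D.gain) * s ^ 24 / D.K ^ 2) :=
        mul_le_mul_of_nonneg_left hG (by positivity)
    _ = D.kbar m * (D.N m : ℝ) ^ 2 * s ^ 32 := by
        field_simp

/-- The growth factor `(K²/(K²+gain)) s_m ^ 8` is eventually `≥ 2`. [folklore] -/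
theorem exists_forall_two_le_growthFactor (hP : D.Permissible) (hsq : ∀ m, D.N m ^ 2 ≤ D.N (m + 1)) :
    ∃ mstar : ℕ, ∀ m, mstar ≤ m → 2 ≤ D.K ^ 2 / (D.K ^ 2 + D.gain) * (((D.N (m + 1) : ℝ) / D.N m) ^ (1 / 16 : ℝ)) ^ 8 := by
  have hK := D.K_pos
  have hg := D.gain_pos
  have hc : 0 < D.K ^ 2 / (D.K ^ 2 + D.gain) := by positivity
  obtain ⟨mstar, h⟩ := exists_forall_le_sep16_pow D hP hsq (2 / (D.K ^ 2 / (D.K ^ 2 + D.gain))) (n := 8) (by norm_num)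
  refine ⟨mstar, fun m hm => ?_⟩
  have h' := h m hm
  rw [div_le_iff₀ hc] at h'
  linarith

/-- **`R_m = kbar m · N m² → ∞`**: threshold form — every bound `B` is below `kbar m · N m²` for all large `m`. [folklore] -/
theorem exists_forall_le_kbar_mul_N_sq (hP : D.Permissible)
    (hT3 : ∀ m, D.K * ((D.N (m + 1) : ℝ) / D.N m) ^ (1 / 4 : ℝ) ≤ ((D.N (m + 1) : ℝ) / D.N m) * D.cellVisc (m + 1))
    (hsq : ∀ m, D.N m ^ 2 ≤ D.N (m + 1)) (B : ℝ) :
    ∃ mstar : ℕ, ∀ m, mstar ≤ m → B ≤ D.kbar m * (D.N m : ℝ) ^ 2 := by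
  obtain ⟨m₀, hm₀⟩ := exists_forall_two_le_growthFactor D hP hsq
  have hR0 : 0 < D.kbar m₀ * (D.N m₀ : ℝ) ^ 2 := by
    have := D.kbar_pos m₀
    have : (0 : ℝ) < D.N m₀ := by exact_mod_cast D.N_pos m₀
    positivity
  -- geometric growth from `m₀` on
  have hgeo : ∀ j : ℕ, (2 : ℝ) ^ j * (D.kbar m₀ * (D.N m₀ : ℝ) ^ 2) ≤ D.kbar (m₀ + j) * (D.N (m₀ + j) : ℝ) ^ 2 := by
    intro j
    induction j with
    | zero => simp
    | succ j ih =>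
      have hstep := R_succ_ge D hP hT3 (m₀ + j)
      have hfac := hm₀ (m₀ + j) (Nat.le_add_right _ _)
      have hRj : 0 ≤ D.kbar (m₀ + j) * (D.N (m₀ + j) : ℝ) ^ 2 := by
        have := D.kbar_pos (m₀ + j)
        positivity
      calc (2 : ℝ) ^ (j + 1) * (D.kbar m₀ * (D.N m₀ : ℝ) ^ 2) = 2 * (2 ^ j * (D.kbar m₀ * (D.N m₀ : ℝ) ^ 2)) := by ring
        _ ≤ 2 * (D.kbar (m₀ + j) * (D.N (m₀ + j) : ℝ) ^ 2) := by linarith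
        _ ≤ D.K ^ 2 / (D.K ^ 2 + D.gain) * (((D.N (m₀ + j + 1) : ℝ) / D.N (m₀ + j)) ^ (1 / 16 : ℝ)) ^ 8 *
              (D.kbar (m₀ + j) * (D.N (m₀ + j) : ℝ) ^ 2) := mul_le_mul_of_nonneg_right hfac hRj
        _ ≤ D.kbar (m₀ + j + 1) * (D.N (m₀ + j + 1) : ℝ) ^ 2 := hstep
  -- `2^j R₀ ≥ B` for large `j`
  have h2 : Tendsto (fun j : ℕ => (2 : ℝ) ^ j * (D.kbar m₀ * (D.N m₀ : ℝ) ^ 2)) atTop atTop :=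
    (tendsto_pow_atTop_atTop_of_one_lt (by norm_num : (1:ℝ) < 2)).atTop_mul_const hR0
  obtain ⟨j₀, hj₀⟩ := eventually_atTop.1 (h2.eventually_ge_atTop B)
  refine ⟨m₀ + j₀, fun m hm => ?_⟩
  obtain ⟨j, rfl⟩ := Nat.exists_eq_add_of_le hm
  have hj : j₀ ≤ j₀ + j := Nat.le_add_right _ _
  calc B ≤ (2 : ℝ) ^ (j₀ + j) * (D.kbar m₀ * (D.N m₀ : ℝ) ^ 2) := hj₀ (j₀ + j) hj
    _ ≤ D.kbar (m₀ + (j₀ + j)) * (D.N (m₀ + (j₀ + j)) : ℝ) ^ 2 := hgeo (j₀ + j)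
    _ = D.kbar (m₀ + j₀ + j) * (D.N (m₀ + j₀ + j) : ℝ) ^ 2 := by rw [Nat.add_assoc]

/-- **`R_m → ∞`** (filter form). [folklore] -/
theorem tendsto_kbar_mul_N_sq_atTop (hP : D.Permissible)
    (hT3 : ∀ m, D.K * ((D.N (m + 1) : ℝ) / D.N m) ^ (1 / 4 : ℝ) ≤ ((D.N (m + 1) : ℝ) / D.N m) * D.cellVisc (m + 1))
    (hsq : ∀ m, D.N m ^ 2 ≤ D.N (m + 1)) :
    Tendsto (fun m => D.kbar m * (D.N m : ℝ) ^ 2) atTop atTop :=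
  tendsto_atTop_atTop.2 fun B => exists_forall_le_kbar_mul_N_sq D hP hT3 hsq B

/-- `R_m = a_m · cellVisc m` (the dissipation scale is the shear rate times the cell viscosity). [folklore] -/
theorem kbar_mul_N_sq_eq_a_mul_cellVisc (m : ℕ) : D.kbar m * (D.N m : ℝ) ^ 2 = D.a m * D.cellVisc m := by
  have ha : D.a m ≠ 0 := (D.a_pos _).ne'
  unfold FractalCarrierData.cellVisc
  field_simp

end Summit.AnomalousDissipation.AnomalousDissipation.Theorems.SolenoidalFractalHomogenisation.LagrangianStep

end
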